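import Literature.NumberTheory.GaloisRepresentations.ContinuousCorestrictionResNormal
import Literature.NumberTheory.GaloisRepresentations.KummerCorestrictionNorm
import Literature.NumberTheory.EllipticCurves.IwasawaTwistModPShapiroConj
import HarnessLib

/-!
# Corestriction bookkeeping between layers: `cor ∘ res = (H′ : H)`, naturality of the relative corestriction in the
# coefficients, and the vanishing of `cor` on classes that become principal in a bigger module

Topic `NumberTheory/GaloisRepresentations`. THEOREMS ONLY, generic (a topological group `G`, open subgroups of finite index
`H ≤ H′`, topological representations `X`, `Y`, `Z` of `G`). Written by the cell `bsd-2adic` seat `bsd-2adic-tower-1` GEN 36 as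
brick C of the H46 universal-norm programme (`HOME/tower/gen36/NOTE-B6-UNIVERSAL-NORMS-GEN36.md`), where the three layers are
`Gal(ℚ̄/ℚ_{n*}) ≤ Gal(ℚ̄/ℚ_n) ≤ Γ_ℚ` and `X = E[p^M] ↪ Z = E[p^∞]`. Nothing about any curve; BSD is not proved by any of this.

* `coresLe_resLe_eq_index_smul` — `cor_{H′/H} (res_{H/H′} c) = [H′ : H] • c` (Serre, Prop. 9 of I §2.4, relative form);
* `coresLe_cohomologyMap_comm` — `cor_{H′/H} ∘ H¹(H, f) = H¹(H′, f) ∘ cor_{H′/H}` for a morphism `f : X ⟶ Y`;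
* `cores_eq_zero_of_forall_eq_sub_of_sum_eq` — if a cocycle `g` on `N` with values in `X` becomes PRINCIPAL in a bigger module
  `Z` (`ι ∘ g = ∂Q`, `ι : X ⟶ Z` injective) and the NORM `Σ_{x ∈ G/N} s(x)·Q` lies in `ι(X)`, then `cor_{G/N} [g] = 0` in `H¹(G, X)`
  (the transfer of `∂Q` is `∂(Σ s(x)·Q)`).
[cite: SerreGaloisCohomology1997, I §2.4 (Prop. 9)] [cite: NeukirchSchmidtWingberg2008, I §5 (1.5.2)–(1.5.7), Prop. 1.5.3]
-/

noncomputable section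

open CategoryTheory

universe u v

namespace Literature.NumberTheory.GaloisRepresentations

open Literature.NumberTheory.EllipticCurves (subgroupInclusion schreierElt)

variable {R : Type u} [CommRing R] [TopologicalSpace R]
variable {G : Type v} [Group G] [TopologicalSpace G] [IsTopologicalGroup G]

/-! ## §1 `cor ∘ res = (H′ : H)` for `H ≤ H′` -/

section CorRes

variable (X : TopRep.{v} R G) {H H' : Subgroup G}

/-- The tautological comparison `toSubgroupOf` turns `res_{H/H′}` into the restriction of the group `H′` to its subgroup
`H.subgroupOf H′` (same cocycle). [cite: SerreGaloisCohomology1997, I §2.4] -/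
theorem toSubgroupOf_resLe_one (h : H ≤ H') (c : continuousCohomology 1 (subgroupRep X H')) :
    toSubgroupOf X h 1 (resLe X h 1 c) = resSubgroup (subgroupRep X H') (H.subgroupOf H') 1 c := by
  obtain ⟨φ, rfl⟩ := oneCocycleClass_surjective _ c
  rw [resLe_oneCocycleClass, toSubgroupOf, map_oneCocycleClass, resSubgroup_oneCocycleClass]
  exact congrArg _ (Subtype.ext (ContinuousMap.ext fun _ ↦ rfl))

/-- **`cor_{H′/H} ∘ res_{H/H′} = (H′ : H)`** on `H¹(H′, X)` for `H ≤ H′`, `H` open of finite index in `H′`.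
[cite: SerreGaloisCohomology1997, I §2.4 (Prop. 9)] -/
theorem coresLe_resLe_eq_index_smul (h : H ≤ H') (hH : IsOpen (H : Set G)) [Fintype (H' ⧸ H.subgroupOf H')]
    (c : continuousCohomology 1 (subgroupRep X H')) :
    coresLe X h hH (resLe X h 1 c) = ((H.subgroupOf H').index : R) • c := by
  rw [coresLe, LinearMap.coe_comp, Function.comp_apply, ContinuousLinearMap.coe_coe]
  change cores _ _ _ (toSubgroupOf X h 1 (resLe X h 1 c)) = _
  rw [toSubgroupOf_resLe_one, cores_resSubgroup]

end CorRes

/-! ## §2 Naturality of `cor_{H′/H}` in the coefficients -/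

section Naturality

variable {X Y : TopRep.{v} R G} {H H' : Subgroup G}

/-- `toSubgroupOf` commutes with a change of coefficients. [cite: SerreGaloisCohomology1997, I §2.4] -/
theorem toSubgroupOf_cohomologyMap_one (f : X ⟶ Y) (h : H ≤ H') (c : continuousCohomology 1 (subgroupRep X H)) :
    toSubgroupOf Y h 1 (cohomologyMap (subgroupRepHom f H) 1 c) =
      cohomologyMap (subgroupRepHom (subgroupRepHom f H') (H.subgroupOf H')) 1 (toSubgroupOf X h 1 c) := by
  obtain ⟨φ, rfl⟩ := oneCocycleClass_surjective _ c
  rw [cohomologyMap_oneCocycleClass, toSubgroupOf, map_oneCocycleClass, toSubgroupOf, map_oneCocycleClass,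
    cohomologyMap_oneCocycleClass]
  exact congrArg _ (Subtype.ext (ContinuousMap.ext fun _ ↦ rfl))

/-- **`cor_{H′/H}` commutes with `H¹(f)`** for a morphism `f : X ⟶ Y` of topological representations of `G` (`H ≤ H′`, `H` open of
finite index in `H′`): `cor_{H′/H} (H¹(H, f) c) = H¹(H′, f) (cor_{H′/H} c)`. [cite: NeukirchSchmidtWingberg2008, I §5 (1.5.2)] -/
theorem coresLe_cohomologyMap_comm (f : X ⟶ Y) (h : H ≤ H') (hH : IsOpen (H : Set G)) [Fintype (H' ⧸ H.subgroupOf H')]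
    (c : continuousCohomology 1 (subgroupRep X H)) :
    coresLe Y h hH (cohomologyMap (subgroupRepHom f H) 1 c) = cohomologyMap (subgroupRepHom f H') 1 (coresLe X h hH c) := by
  rw [coresLe, coresLe, LinearMap.coe_comp, LinearMap.coe_comp, Function.comp_apply, Function.comp_apply,
    ContinuousLinearMap.coe_coe, ContinuousLinearMap.coe_coe]
  change cores _ _ _ (toSubgroupOf Y h 1 (cohomologyMap (subgroupRepHom f H) 1 c)) =
    cohomologyMap (subgroupRepHom f H') 1 (cores _ _ _ (toSubgroupOf X h 1 c))
  rw [toSubgroupOf_cohomologyMap_one, cohomologyMap_cores]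

end Naturality

/-! ## §3 `cor` kills a class that becomes principal in a bigger module whose norm lands in the small one -/

section Principal

variable {X Z : TopRep.{v} R G} (N : Subgroup G) [Fintype (G ⧸ N)] {s : G ⧸ N → G}

/-- **`cor [g] = 0` for a cocycle principal in a bigger module with norm in the small one.** Let `ι : X ⟶ Z` be a morphism of
topological representations of `G` injective on points, `g` a continuous `1`-cocycle of the open finite-index subgroup `N` with values in
`X` such that `ι(g(n)) = n·Q − Q` for some `Q ∈ Z`, and suppose the norm `Σ_{x ∈ G/N} s(x)·Q` is `ι(x₀)`. Then `cor_{G/N} [g] = 0` in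
`H¹(G, X)`: the transfer of `g`, read in `Z`, is `∂(Σ s(x)·Q) = ∂(ι x₀) = ι ∘ ∂x₀`. (Use: `X = E[p^M]`, `Z = E[p^∞]`, `p^M Q` a point
rational over the fixed field of `N`, so that `Σ s(x)·Q ∈ E[p^M]` as soon as the norm of `p^M Q` vanishes.)
[cite: NeukirchSchmidtWingberg2008, I §5 (corestriction on inhomogeneous cochains, (1.5.2))] -/
theorem cores_eq_zero_of_forall_eq_sub_of_sum_eq (hN : IsOpen (N : Set G)) (hs : ∀ x : G ⧸ N, (s x : G ⧸ N) = x)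
    (ι : X ⟶ Z) (hι : Function.Injective ι.hom) (g : contOneCocycles (subgroupRep X N)) (Q : Z)
    (hg : ∀ n : N, ι.hom (g.1 n) = Z.ρ (n : G) Q - Q) (x₀ : X) (hx₀ : ι.hom x₀ = ∑ x : G ⧸ N, Z.ρ (s x) Q) :
    cores X N hN (oneCocycleClass _ g) = 0 := by
  rw [cores_oneCocycleClass X N hN hs, oneCocycleClass_eq_zero_iff]
  refine ⟨x₀, fun a ↦ hι ?_⟩
  -- the transfer read in `Z` is the transfer of the `Z`-valued cocycle `ι ∘ g`, i.e. `∂(Σ s(x)·Q)`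
  let g' : contOneCocycles (subgroupRep Z N) :=
    contOneCocycles.pullback (ContinuousMonoidHom.id _) (resIdHom (subgroupRepHom ι N)) g
  have hgg' : ∀ n : N, g'.1 n = ι.hom (g.1 n) := fun n ↦ by
    rw [pullback_id_resIdHom_apply, subgroupRepHom_hom_apply]
  have hg' : ∀ n : N, g'.1 n = Z.ρ (n : G) Q - Q := fun n ↦ by rw [hgg', hg]
  have h1 : ι.hom (transferFun X N hs g a) = transferFun Z N hs g' a :=
    (transferFun_congr_of_hom Z N hs X ι.hom.toLinearMap.toAddMonoidHom (fun b y ↦ TopRep.hom_comm_apply ι b y) g g'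
      hgg' a).symm
  rw [transferCocycle_apply, h1, transferFun_eq_of_forall_eq_sub Z N hs g' Q hg' a, map_sub, TopRep.hom_comm_apply, hx₀]

end Principal

end Literature.NumberTheory.GaloisRepresentations

end
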